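import Summits.QuantumFields.BalabanUV.Beta.FP.PerfectStencilFixedPoint
import Summits.QuantumFields.BalabanUV.Beta.GAN24.StencilSlotCauchyOfShapes

/-!
# `BalabanUV.Beta.FP.PureStencilRows` — road «FP» for binder row D1, row **N1-J∞-W** COMPANION (leaf-06 g13, INTENT 1 journal l.31734), FILE 1∕2:
# THE (S♭) ROWS OF THE SECOND-ORDER FIXED-POINT EQUATION — uniform class, limit and geometric rate of the unit-rescaled PURE first-order tables
# `unitS_j (SpureRecOf V H G cE cVH cΛ j)` — FOLLOW FROM THE END's OWN S-ROWS `hS0 hSall0` (about the full `SrecOf`) AND THE K-SLOT, generic `d`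

HONEST DEPENDENCY (page 1, mandatory): continuum YM on T⁴ ⇐ BetaPertH ∧ nine spine estimates (0/9 proved); BetaPertH ⇐ (D1) ∧ (D4) ∧ CAP+tail;
G-an2-4 gates asym, D1 and NE2/3/4.  HONEST FRAMING (cell contract, verbatim): «discharging `BetaPertH` makes Bałaban's UV stability UNCONDITIONAL —
a real constructive-QFT result; it is NOT the continuum limit and NOT the Clay problem.»  THIS MODULE is [folklore] real analysis over the tree's typed
objects (no `def`, no `def … : Prop`, nothing cited, 0 sorry): every row below is a HYPOTHESIS SHAPE with free constants, asserted for no object of Bałaban's.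
0∕4 row-D1 binders; discharges NO (CONV-C) row of the END and NO table letter; NOT N2, NOT SDF, NOT D1, NOT BetaPertH, NOT continuum, NOT Clay.
«not in print; our bookkeeping».

ABSOLUTE RULE (cell charter, verbatim): «No internally-minted statement may enter as a cited fact. Every hypothesis is either kernel-proved in this package or a
verbatim quotation of a PUBLISHED theorem with page reference. The manuscript(s) under audit are NOT citable for their own disputed steps — they are the thing
under adjudication; programme-internal (2001/route/tribunal) claims are never citable.»

WHY (leaf-02 g12's `PerfectTableFixedPoint` p272173, RESIDUAL (S♭); my X2 read C-d1leaf06g13-2 INFO-3): the S-slot of an2's second-order carrier `W2SymOfK` at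
step `j` is the PURE table `SpureRecOf … j` (`WrecOf_eq`), so the fixed-point equation `limTabOf_unitW_JsB12Sym0_eq` displays three rows about `unitS_j (SpureRecOf … j)`
— an object for which nobody holds rows; the END (`RoadLeftLiteralWard…`) displays its S-rows `hS0 hSall0` about the FULL stencils `unitS_j (SrecOf … j)`.  The
two differ by the Λ-slot: `SrecOf (j+1) = SpureRecOf (j+1) + (cΛ·wΛ (j+1)) • S^Λ[lamCoeffK (KInvStep Lc (j+1)) (E2 (j+1))] H` (`SrecOf_eq_SpureRecOf_add_lam_succ`),
in units `(cΛ·Lc^{2(d+1)}) • S^Λ[lamCoeffK K̃_{j+1} (mmRead Lc K̃_j)] H` (leaf-06 g12 `PerfectStencilStep.unitS_lamSlot_eq`, (ShH)), whose coefficients are ONE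
entry of `K̃_{j+1} ∘ mmRead K̃_j` — so the Λ-slot inherits class, limit and geometric rate from the K-slot (`KStepUnit Lc j → K₁`), and the (S♭) rows follow
from `hS0 hSall0` + K-slot + the letters of `V`, `H`.  Member `0` is `cE • wilsonA + cVH • V` (no Λ, no `K`).

CONTENT ([folklore]; generic `d`, `[NeZero Lc]`, `1 ≤ Lc`; K-slot rows `Decays (KStepUnit Lc j) C δ`, `Decays K₁ C δ`, `Decays (KStepUnit Lc j − K₁) (cK·θ^j) δ`).
* §1 `abs_lamCoeffK_KStepUnit_sub_lim_le` — the multiplier-response coefficients TO THE LIMIT: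
  `|lamCoeffK K̃_{j+1} (mmRead Lc K̃_j) Lc μ y κ u − lamCoeffK K₁ (mmRead Lc K₁) Lc μ y κ u| ≤ (2·|Fib d|·C·cK·Zl(δ∕2))·θ^j·e^{−(δ∕2)|Lc•y − u|₁}` (`0 ≤ θ ≤ 1`).
* §2 `locStencil_SLam_KStepUnit` ∕ `locStencil_SLam_lim` ∕ `locStencil_SLam_KStepUnit_sub_lim` — the unit Λ-stencils `S^Λ[c_{j+1}] H`, their limit `S^Λ[c∞] H` and
  the difference (as ONE stencil `S^Λ[c_{j+1} − c∞] H`, and as the Pi-difference) in `LocStencil`, rate `δ∕4`, from ONE letter `VertexFamily H Lc CH (δ∕2)`.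
* §3 `unitS_SpureRecOf_zero` (member `0` in unit `1` is `cE • wilsonA + cVH • V`), `unitS_SpureRecOf_succ` (the Λ-SPLIT IN UNITS under the (ShH) entry letters:
  `unitS_{j+1} (SpureRecOf (j+1)) = unitS_{j+1} (SrecOf (j+1)) − (cΛ·Lc^{2(d+1)}) • S^Λ[c_{j+1}] H`).
* §4 **`pureRows_of_rows`** — from (ShH), `VertexFamily H Lc CH (δ∕2)`, `LocStencil V CV m`, the K-slot rows (`0 < δ`, `0 ≤ θ < 1`) and the END-shape S-rows
  `hS0`∕`hSall0` (ratio `0 ≤ θS < 1`, rate `δS`), at any rate `0 < m ≤ min (δ∕4) δS`:  `∃ Cs cS'`, (i) `∀ j, LocStencil (unitS_j (SpureRecOf … j)) Cs m`, (ii)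
  `LocStencil S♭∞ Cs m`, (iii) `∀ j, LocStencil (unitS_j (SpureRecOf … j) − S♭∞) (cS'·θ⋆^j) m`, `θ⋆ := max (max θ θS) (1∕2)`, with the EXPLICIT pure limit
  **`S♭∞ := limStOf (j ↦ unitS_j (SrecOf … j)) − fun κ u => (cΛ·Lc^{2(d+1)}) • S^Λ[lamCoeffK K₁ (mmRead Lc K₁) Lc] H κ u`** — EXACTLY the `hS hSinf hSrate` hypothesis
  shapes of `PerfectTableFixedPoint.limTabOf_unitW_JsB12Sym0_eq` (FILE 2 instantiates them at the (0.4) literal).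
NOT HERE: any (CONV-C) row (the S-rows and the K-slot stay hypotheses); the (S₂)-slot; the literal (FILE 2).
Provenance: D1 formalisation swarm LEAF PROVER 06, unit b2b-balaban-beta-d1-formalise-leaf-06 gen 13, 2026-08-21.  Over gan24's `StencilSlotLamDrift` (`SLam_sub`,
`lamCoeffK_sub`), `StencilSlotCauchyOfShapes.locStencil_sub`, `StencilSlotOfShapes`, `ThirdJetKernel.mmRead_sub`, an2's `InterLevelTransport.locStencil_SLam` ∕
`BalabanStepJetsSucc.abs_lamCoeffK_le` ∕ `decays_mmRead`, asym1's `HessKerDressedLimit`, leaf-06's `PerfectStencilStep` ∕ `PerfectStencilFixedPoint` BY NAME; no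
existing file touched.
-/

noncomputable section

open Literature.MathematicalPhysics.QuantumFieldTheory
open Literature.MathematicalPhysics.QuantumFieldTheory.Balaban1983to89
open Literature.MathematicalPhysics.QuantumFieldTheory.Balaban1983to89.Beta
open B12Sec2to5 (l1 l1_nonneg)
open ExpKernelCalculus (MKer Decays BiLoc VertexFamily Zl Zl_nonneg)
open OneStepResolventKernel (Fib LocStencil)
open BalabanStepJets (locStencil_mono)
open InterLevelTransport (SLam locStencil_SLam)
open BalabanStepJetsSucc (mmRead lamCoeffK abs_lamCoeffK_le decays_mmRead)
open StepJetData (wilsonA wBound wBound_nonneg locStencil_wilsonA locStencil_add locStencil_smul)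
open HessKerDressedLimit (limStOf locStencil_limStOf locStencil_sub_limStOf)
open Summit.QuantumFields.BalabanUV.Beta.HessKerDressedUnits (unitK unitS unitS_sub)
open Summit.QuantumFields.BalabanUV.Beta.GAN24.CombesThomas (sfStep smStep KStepUnit)
open Summit.QuantumFields.BalabanUV.Beta.GAN24.StencilSlotOfShapes (unitS_step_zero locStencil_mono')
open Summit.QuantumFields.BalabanUV.Beta.GAN24.StencilSlotCauchyOfShapes (locStencil_sub)
open Summit.QuantumFields.BalabanUV.Beta.GAN24.StencilSlotLamDrift (SLam_sub lamCoeffK_sub)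
open Summit.QuantumFields.BalabanUV.Beta.GAN24.ThirdJetKernel (mmRead_sub)
open Summit.QuantumFields.BalabanUV.Beta.WardLocusRecursive (SrecOf)
open Summit.QuantumFields.BalabanUV.Beta.SpineRooted (SpureRecOf SpureRecOf_zero_level SrecOf_eq_SpureRecOf_add_lam_succ)
open Summit.QuantumFields.BalabanUV.Beta.FP.PerfectStencilStep (unitS_lamSlot_eq)
open Summit.QuantumFields.BalabanUV.Beta.FP.PerfectStencilFixedPoint (abs_lamCoeffK_KStepUnit_le)

namespace Summit.QuantumFields.BalabanUV.Beta.FP.PureStencilRows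

variable {d : ℕ} {Lc : ℕ} [NeZero Lc]

/-! ## §1 The multiplier-response coefficients converge at the K-slot's geometric rate -/

section Coefficients

variable {K₁ : MKer (d + 1) (Fib d)} {C cK δ θ : ℝ}

/-- [folklore] **THE STEP MULTIPLIER RESPONSE TO THE LIMIT, QUANTIFIED**: with the K-slot rows (uniform `Decays (K̃_j) C δ`, limit `Decays K₁ C δ`, rate
`Decays (K̃_j − K₁) (cK·θ^j) δ`; `0 < δ`, `0 ≤ θ ≤ 1`, `1 ≤ Lc`), the conversion coefficients of the unit Λ-slot satisfy
`|lamCoeffK K̃_{j+1} (mmRead Lc K̃_j) Lc μ y κ u − lamCoeffK K₁ (mmRead Lc K₁) Lc μ y κ u| ≤ (2·|Fib d|·C·cK·Zl(δ − δ∕2))·θ^j·e^{−(δ∕2)|Lc•y − u|₁}` —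
telescoping at the `comp` entry (gan24 `lamCoeffK_sub`) + an2's `abs_lamCoeffK_le` twice (`mmRead` keeps `Decays` and is linear). -/
theorem abs_lamCoeffK_KStepUnit_sub_lim_le (hLc : 1 ≤ Lc) (hK : ∀ j, Decays (KStepUnit (d := d) Lc j) C δ) (hKinf : Decays K₁ C δ)
    (hKrate : ∀ j, Decays (KStepUnit (d := d) Lc j - K₁) (cK * θ ^ j) δ) (hδ : 0 < δ) (hθ0 : 0 ≤ θ) (hθ1 : θ ≤ 1)
    (j : ℕ) (μ : Fin (d + 1)) (y : Fin (d + 1) → ℤ) (κ : Fin (d + 1)) (u : Fin (d + 1) → ℤ) :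
    |lamCoeffK (KStepUnit (d := d) Lc (j + 1)) (mmRead Lc (KStepUnit (d := d) Lc j)) Lc μ y κ u - lamCoeffK K₁ (mmRead Lc K₁) Lc μ y κ u| ≤
      ((2 * ((Fintype.card (Fib d) : ℝ) * (C * cK) * Zl (d + 1) (δ - δ / 2))) * θ ^ j) * Real.exp (-(δ / 2) * l1 ((Lc : ℤ) • y - u)) := by
  have hA₁ : Decays (KStepUnit (d := d) Lc (j + 1)) C δ := hK (j + 1)
  have hE₁ : Decays (mmRead Lc (KStepUnit (d := d) Lc j)) C δ := decays_mmRead hLc (hK j) hδ.le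
  have hE₂ : Decays (mmRead Lc K₁) C δ := decays_mmRead hLc hKinf hδ.le
  have hA₁₂ : Decays (KStepUnit (d := d) Lc (j + 1) - K₁) (cK * θ ^ (j + 1)) δ := hKrate (j + 1)
  have hE₁₂ : Decays (mmRead Lc (KStepUnit (d := d) Lc j) - mmRead Lc K₁) (cK * θ ^ j) δ := by
    rw [← mmRead_sub]; exact decays_mmRead hLc (hKrate j) hδ.le
  have hC : 0 ≤ C := (hK 0).nonneg (Sum.inl 0)
  have hcK : 0 ≤ cK := by have h := (hKrate 0).nonneg (Sum.inl 0); simpa using h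
  have hZ : 0 ≤ Zl (d + 1) (δ - δ / 2) := Zl_nonneg (by linarith)
  have hF : (0 : ℝ) ≤ Fintype.card (Fib d) := Nat.cast_nonneg _
  have hθj : θ ^ (j + 1) ≤ θ ^ j := by
    rw [pow_succ]; exact mul_le_of_le_one_right (pow_nonneg hθ0 j) hθ1
  rw [lamCoeffK_sub hA₁ hKinf hE₁ hE₂ hδ]
  refine (abs_add_le _ _).trans ?_
  refine (add_le_add (abs_lamCoeffK_le hA₁₂ hE₁ hδ Lc μ y κ u) (abs_lamCoeffK_le hKinf hE₁₂ hδ Lc μ y κ u)).trans ?_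
  rw [← add_mul]
  refine mul_le_mul_of_nonneg_right ?_ (Real.exp_pos _).le
  have hA : 0 ≤ (Fintype.card (Fib d) : ℝ) * (C * cK) * Zl (d + 1) (δ - δ / 2) := by positivity
  calc (Fintype.card (Fib d) : ℝ) * (cK * θ ^ (j + 1) * C) * Zl (d + 1) (δ - δ / 2) +
          (Fintype.card (Fib d) : ℝ) * (C * (cK * θ ^ j)) * Zl (d + 1) (δ - δ / 2)
        = ((Fintype.card (Fib d) : ℝ) * (C * cK) * Zl (d + 1) (δ - δ / 2)) * θ ^ (j + 1) +
            ((Fintype.card (Fib d) : ℝ) * (C * cK) * Zl (d + 1) (δ - δ / 2)) * θ ^ j := by ring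
    _ ≤ ((Fintype.card (Fib d) : ℝ) * (C * cK) * Zl (d + 1) (δ - δ / 2)) * θ ^ j +
            ((Fintype.card (Fib d) : ℝ) * (C * cK) * Zl (d + 1) (δ - δ / 2)) * θ ^ j :=
          add_le_add (mul_le_mul_of_nonneg_left hθj hA) le_rfl
    _ = (2 * ((Fintype.card (Fib d) : ℝ) * (C * cK) * Zl (d + 1) (δ - δ / 2))) * θ ^ j := by ring

end Coefficients

/-! ## §2 The unit Λ-stencils, their limit and their difference in `LocStencil` (rate `δ∕4`) -/

section LamStencils

variable {H : Fin (d + 1) → (Fin (d + 1) → ℤ) → MKer (d + 1) (Fib d)} {K₁ : MKer (d + 1) (Fib d)} {C cK CH δ θ : ℝ}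

/-- [folklore] **THE UNIT Λ-STENCIL OF MEMBER `j+1` IS A LOCAL STENCIL FAMILY**, uniformly in `j`: from the uniform K-row and ONE letter
`VertexFamily H Lc CH (δ∕2)` — `LocStencil (S^Λ[lamCoeffK K̃_{j+1} (mmRead Lc K̃_j)] H) ((d+1)·((|Fib d|·C²·Zl(δ−δ∕2))·CH·Zl(δ∕4))) (δ∕4)`
(`locStencil_SLam` over leaf-06 g12's `abs_lamCoeffK_KStepUnit_le`). -/
theorem locStencil_SLam_KStepUnit (hLc : 1 ≤ Lc) (hK : ∀ j, Decays (KStepUnit (d := d) Lc j) C δ) (hδ : 0 < δ)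
    (hH : VertexFamily H Lc CH (δ / 2)) (j : ℕ) :
    LocStencil (SLam Lc (lamCoeffK (KStepUnit (d := d) Lc (j + 1)) (mmRead Lc (KStepUnit (d := d) Lc j)) Lc) H)
      ((d + 1 : ℕ) * (((Fintype.card (Fib d) : ℝ) * (C * C) * Zl (d + 1) (δ - δ / 2)) * CH * Zl (d + 1) (δ / 2 / 2))) (δ / 2 / 2) := by
  have hC : 0 ≤ C := (hK 0).nonneg (Sum.inl 0)
  have hZ : 0 ≤ Zl (d + 1) (δ - δ / 2) := Zl_nonneg (by linarith)
  exact locStencil_SLam (N := Lc) (fun μ y κ u => abs_lamCoeffK_KStepUnit_le hLc hK hδ j μ y κ u) hH (half_pos hδ) (by positivity)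

/-- [folklore] **THE LIMIT Λ-STENCIL IS A LOCAL STENCIL FAMILY**, same constant: `LocStencil (S^Λ[lamCoeffK K₁ (mmRead Lc K₁)] H) (…) (δ∕4)` from `Decays K₁ C δ`. -/
theorem locStencil_SLam_lim (hLc : 1 ≤ Lc) (hKinf : Decays K₁ C δ) (hδ : 0 < δ) (hH : VertexFamily H Lc CH (δ / 2)) :
    LocStencil (SLam Lc (lamCoeffK K₁ (mmRead Lc K₁) Lc) H)
      ((d + 1 : ℕ) * (((Fintype.card (Fib d) : ℝ) * (C * C) * Zl (d + 1) (δ - δ / 2)) * CH * Zl (d + 1) (δ / 2 / 2))) (δ / 2 / 2) := by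
  have hC : 0 ≤ C := hKinf.nonneg (Sum.inl 0)
  have hZ : 0 ≤ Zl (d + 1) (δ - δ / 2) := Zl_nonneg (by linarith)
  exact locStencil_SLam (N := Lc) (fun μ y κ u => abs_lamCoeffK_le hKinf (decays_mmRead hLc hKinf hδ.le) hδ Lc μ y κ u) hH (half_pos hδ)
    (by positivity)

/-- [folklore] **THE DIFFERENCE OF THE UNIT Λ-STENCIL AND ITS LIMIT, ENTRYWISE, IS THE Λ-STENCIL OF THE COEFFICIENT DIFFERENCE** (gan24 `SLam_sub`, summability
from the K-rows and the `H` letter). -/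
theorem SLam_KStepUnit_sub_lim_apply (hLc : 1 ≤ Lc) (hK : ∀ j, Decays (KStepUnit (d := d) Lc j) C δ) (hKinf : Decays K₁ C δ) (hδ : 0 < δ)
    (hH : VertexFamily H Lc CH (δ / 2)) (j : ℕ) (κ : Fin (d + 1)) (u x z : Fin (d + 1) → ℤ) (a b : Fib d) :
    SLam Lc (lamCoeffK (KStepUnit (d := d) Lc (j + 1)) (mmRead Lc (KStepUnit (d := d) Lc j)) Lc) H κ u x z a b -
        SLam Lc (lamCoeffK K₁ (mmRead Lc K₁) Lc) H κ u x z a b =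
      SLam Lc (fun μ y κ u => lamCoeffK (KStepUnit (d := d) Lc (j + 1)) (mmRead Lc (KStepUnit (d := d) Lc j)) Lc μ y κ u -
        lamCoeffK K₁ (mmRead Lc K₁) Lc μ y κ u) H κ u x z a b := by
  have hC : 0 ≤ C := (hK 0).nonneg (Sum.inl 0)
  have hZ : 0 ≤ Zl (d + 1) (δ - δ / 2) := Zl_nonneg (by linarith)
  have hCC : 0 ≤ (Fintype.card (Fib d) : ℝ) * (C * C) * Zl (d + 1) (δ - δ / 2) := by positivity
  exact SLam_sub (N := Lc) (fun μ y κ u => abs_lamCoeffK_KStepUnit_le hLc hK hδ j μ y κ u)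
    (fun μ y κ u => abs_lamCoeffK_le hKinf (decays_mmRead hLc hKinf hδ.le) hδ Lc μ y κ u) hH (half_pos hδ) hCC hCC κ u x z a b

/-- [folklore] **THE UNIT Λ-STENCIL MINUS ITS LIMIT IS A LOCAL STENCIL FAMILY WITH A GEOMETRIC CONSTANT**: from the three K-rows (`0 < δ`, `0 ≤ θ ≤ 1`) and the `H`
letter, `LocStencil (S^Λ[c_{j+1}] H − S^Λ[c∞] H) ((d+1)·(((2·|Fib d|·C·cK·Zl(δ−δ∕2))·θ^j)·CH·Zl(δ∕4))) (δ∕4)` (§1 + `locStencil_SLam` + `SLam_sub`). -/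
theorem locStencil_SLam_KStepUnit_sub_lim (hLc : 1 ≤ Lc) (hK : ∀ j, Decays (KStepUnit (d := d) Lc j) C δ) (hKinf : Decays K₁ C δ)
    (hKrate : ∀ j, Decays (KStepUnit (d := d) Lc j - K₁) (cK * θ ^ j) δ) (hδ : 0 < δ) (hθ0 : 0 ≤ θ) (hθ1 : θ ≤ 1)
    (hH : VertexFamily H Lc CH (δ / 2)) (j : ℕ) :
    LocStencil (SLam Lc (lamCoeffK (KStepUnit (d := d) Lc (j + 1)) (mmRead Lc (KStepUnit (d := d) Lc j)) Lc) H -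
        SLam Lc (lamCoeffK K₁ (mmRead Lc K₁) Lc) H)
      ((d + 1 : ℕ) * (((2 * ((Fintype.card (Fib d) : ℝ) * (C * cK) * Zl (d + 1) (δ - δ / 2))) * θ ^ j) * CH * Zl (d + 1) (δ / 2 / 2)))
      (δ / 2 / 2) := by
  have hC : 0 ≤ C := (hK 0).nonneg (Sum.inl 0)
  have hcK : 0 ≤ cK := by have h := (hKrate 0).nonneg (Sum.inl 0); simpa using h
  have hZ : 0 ≤ Zl (d + 1) (δ - δ / 2) := Zl_nonneg (by linarith)
  have hCd : 0 ≤ (2 * ((Fintype.card (Fib d) : ℝ) * (C * cK) * Zl (d + 1) (δ - δ / 2))) * θ ^ j := by positivity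
  have hS := locStencil_SLam (N := Lc) (fun μ y κ u => abs_lamCoeffK_KStepUnit_sub_lim_le hLc hK hKinf hKrate hδ hθ0 hθ1 j μ y κ u) hH
    (half_pos hδ) hCd
  intro κ u x z a b
  have h := hS κ u x z a b
  rw [← SLam_KStepUnit_sub_lim_apply hLc hK hKinf hδ hH j κ u x z a b] at h
  simpa only [Pi.sub_apply] using h

end LamStencils

/-! ## §3 The Λ-split of the slotted recursion, in the adopted units -/

section Split

variable (V H : Fin (d + 1) → (Fin (d + 1) → ℤ) → MKer (d + 1) (Fib d)) (G : ℕ → MKer (d + 1) (Fib d)) (cE cVH cΛ : ℝ)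

/-- [folklore] **MEMBER `0` OF THE PURE FAMILY IN UNITS**: `unitS (sfStep Lc 0) (smStep d Lc 0) (SpureRecOf … 0) = fun κ u => cE • wilsonA d κ u + cVH • V κ u` (unit `1`). -/
theorem unitS_SpureRecOf_zero :
    unitS (sfStep Lc 0) (smStep d Lc 0) (SpureRecOf d Lc V H G cE cVH cΛ 0) = fun κ u => cE • wilsonA d κ u + cVH • V κ u := by
  rw [unitS_step_zero, SpureRecOf_zero_level]

/-- [folklore] **THE Λ-SPLIT IN UNITS, MEMBERS `j+1`** (under the (ShH) entry letters of `H`):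
`unitS_{j+1} (SpureRecOf … (j+1)) = unitS_{j+1} (SrecOf … (j+1)) − fun κ u => (cΛ·Lc^{2(d+1)}) • S^Λ[lamCoeffK K̃_{j+1} (mmRead Lc K̃_j)] H κ u`
(`SrecOf_eq_SpureRecOf_add_lam_succ`, `unitS_sub`, leaf-06 g12's `PerfectStencilStep.unitS_lamSlot_eq`). -/
theorem unitS_SpureRecOf_succ (hHfm : ∀ μ y x z (α ν : Fin (d + 1)), H μ y x z (Sum.inl α) (Sum.inr ν) = 0)
    (hHm : ∀ μ y x z (ν : Fin (d + 1)) (b : Fib d), H μ y x z (Sum.inr ν) b = 0) (j : ℕ) :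
    unitS (sfStep Lc (j + 1)) (smStep d Lc (j + 1)) (SpureRecOf d Lc V H G cE cVH cΛ (j + 1)) =
      unitS (sfStep Lc (j + 1)) (smStep d Lc (j + 1)) (SrecOf d Lc V H G cE cVH cΛ (j + 1)) -
        fun κ u => (cΛ * (Lc : ℝ) ^ (2 * (d + 1))) •
          SLam Lc (lamCoeffK (KStepUnit (d := d) Lc (j + 1)) (mmRead Lc (KStepUnit (d := d) Lc j)) Lc) H κ u := by
  have hsplit : SpureRecOf d Lc V H G cE cVH cΛ (j + 1) = SrecOf d Lc V H G cE cVH cΛ (j + 1) -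
      fun κ u => (cΛ * BalabanStepJetsSucc.wΛ d Lc (j + 1)) •
        SLam Lc (lamCoeffK (OneStepKernelFamily.KInvStep (d := d) Lc (j + 1)) (BalabanStepJetsSucc.E2 d Lc (j + 1)) Lc) H κ u := by
    funext κ u
    rw [Pi.sub_apply, Pi.sub_apply, SrecOf_eq_SpureRecOf_add_lam_succ, add_sub_cancel_right]
  rw [hsplit, unitS_sub, unitS_lamSlot_eq H hHfm hHm cΛ j]

end Split

/-! ## §4 THE (S♭) ROWS from the END's S-rows and the K-slot -/

section Rows

variable (V H : Fin (d + 1) → (Fin (d + 1) → ℤ) → MKer (d + 1) (Fib d)) (G : ℕ → MKer (d + 1) (Fib d)) (cE cVH cΛ : ℝ)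

/-- [folklore] `θ^j ≤ 2·θ⋆^{j+1}` for `0 ≤ θ ≤ θ⋆` and `1∕2 ≤ θ⋆`. -/
theorem pow_le_two_mul_pow_succ {θ θ' : ℝ} (hθ0 : 0 ≤ θ) (hθ : θ ≤ θ') (hhalf : 1 / 2 ≤ θ') (j : ℕ) : θ ^ j ≤ 2 * θ' ^ (j + 1) := by
  have h1 : θ ^ j ≤ θ' ^ j := pow_le_pow_left₀ hθ0 hθ j
  have h2 : 0 ≤ θ' ^ j := pow_nonneg (hθ0.trans hθ) j
  rw [pow_succ]
  nlinarith

/-- [our object — bookkeeping] **THE (S♭) ROWS OF `PerfectTableFixedPoint.limTabOf_unitW_JsB12Sym0_eq` FOLLOW FROM THE END's S-ROWS AND THE K-SLOT.**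
HYPOTHESES (all displayed; none is a (CONV-C) discharge): (ShH) entry letters of `H`; ONE letter `VertexFamily H Lc CH (δ∕2)` and ONE letter `LocStencil V CV m`; the K-slot
rows `Decays (KStepUnit Lc j) C δ`, `Decays K₁ C δ`, `Decays (KStepUnit Lc j − K₁) (cK·θ^j) δ` (`0 < δ`, `0 ≤ θ < 1`, `1 ≤ Lc`); the END-shape S-rows `hS0` (uniform
`LocStencil`, constant `Cs0`, rate `δS`) and `hSall0` (geometric `LocStencil`-Cauchy data `cS·θS^k`, rate `δS`; `0 ≤ θS < 1`) of the FULL unit stencils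
`S̃_j := unitS_j (SrecOf V H G cE cVH cΛ j)`; a target rate `0 < m ≤ δ∕4`, `m ≤ δS`.  CONCLUSION: with `S∞ := limStOf S̃`, the EXPLICIT pure limit
`S♭∞ := S∞ − fun κ u => (cΛ·Lc^{2(d+1)}) • S^Λ[lamCoeffK K₁ (mmRead Lc K₁) Lc] H κ u` and the ratio `θ⋆ := max (max θ θS) (1∕2)`, there are constants `Cs`, `cS'` with
(i) `∀ j, LocStencil (unitS_j (SpureRecOf … j)) Cs m`, (ii) `LocStencil S♭∞ Cs m`, (iii) `∀ j, LocStencil (unitS_j (SpureRecOf … j) − S♭∞) (cS'·θ⋆^j) m` — the three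
(S♭) hypothesis SHAPES of leaf-02's fixed-point equation, literally.  Route: member `0` = `cE • wilsonA + cVH • V` (`locStencil_wilsonA`, the `V` letter); members `j+1` =
`S̃_{j+1} − Λ̃_{j+1}` (§3) with `Λ̃_{j+1} → Λ̃∞` at the K-slot's rate (§2) and `S̃_{j+1} → S∞` at the END's rate (`locStencil_limStOf`∕`locStencil_sub_limStOf`);
`θS^{j+1}, θ^j ≤ 2·θ⋆^{j+1}` merges the ratios.  Discharges nothing. -/
theorem pureRows_of_rows (hLc : 1 ≤ Lc)
    (hHfm : ∀ μ y x z (α ν : Fin (d + 1)), H μ y x z (Sum.inl α) (Sum.inr ν) = 0)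
    (hHm : ∀ μ y x z (ν : Fin (d + 1)) (b : Fib d), H μ y x z (Sum.inr ν) b = 0)
    {K₁ : MKer (d + 1) (Fib d)} {C cK δ θ : ℝ} (hδ : 0 < δ) (hθ0 : 0 ≤ θ) (hθ1 : θ < 1)
    (hK : ∀ j, Decays (KStepUnit (d := d) Lc j) C δ) (hKinf : Decays K₁ C δ)
    (hKrate : ∀ j, Decays (KStepUnit (d := d) Lc j - K₁) (cK * θ ^ j) δ)
    {CH : ℝ} (hH : VertexFamily H Lc CH (δ / 2))
    {Cs0 cS δS θS : ℝ}
    (hS0 : ∀ j, LocStencil (unitS (sfStep Lc j) (smStep d Lc j) (SrecOf d Lc V H G cE cVH cΛ j)) Cs0 δS)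
    (hSall0 : ∀ k j, LocStencil (unitS (sfStep Lc (k + j)) (smStep d Lc (k + j)) (SrecOf d Lc V H G cE cVH cΛ (k + j)) -
      unitS (sfStep Lc k) (smStep d Lc k) (SrecOf d Lc V H G cE cVH cΛ k)) (cS * θS ^ k) δS)
    (hθS0 : 0 ≤ θS) (hθS1 : θS < 1)
    {m : ℝ} (hm : 0 < m) (hmδ : m ≤ δ / 2 / 2) (hmS : m ≤ δS) {CV : ℝ} (hV : LocStencil V CV m) :
    ∃ Cs cS' : ℝ,
      (∀ j, LocStencil (unitS (sfStep Lc j) (smStep d Lc j) (SpureRecOf d Lc V H G cE cVH cΛ j)) Cs m) ∧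
      LocStencil (limStOf (fun j => unitS (sfStep Lc j) (smStep d Lc j) (SrecOf d Lc V H G cE cVH cΛ j)) -
          fun κ u => (cΛ * (Lc : ℝ) ^ (2 * (d + 1))) • SLam Lc (lamCoeffK K₁ (mmRead Lc K₁) Lc) H κ u) Cs m ∧
      ∀ j, LocStencil (unitS (sfStep Lc j) (smStep d Lc j) (SpureRecOf d Lc V H G cE cVH cΛ j) -
          (limStOf (fun j => unitS (sfStep Lc j) (smStep d Lc j) (SrecOf d Lc V H G cE cVH cΛ j)) -
            fun κ u => (cΛ * (Lc : ℝ) ^ (2 * (d + 1))) • SLam Lc (lamCoeffK K₁ (mmRead Lc K₁) Lc) H κ u))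
        (cS' * (max (max θ θS) (1 / 2)) ^ j) m := by
  -- names
  set St : ℕ → Fin (d + 1) → (Fin (d + 1) → ℤ) → MKer (d + 1) (Fib d) :=
    fun j => unitS (sfStep Lc j) (smStep d Lc j) (SrecOf d Lc V H G cE cVH cΛ j) with hSt
  set c' : ℝ := cΛ * (Lc : ℝ) ^ (2 * (d + 1)) with hc'
  set Lt : ℕ → Fin (d + 1) → (Fin (d + 1) → ℤ) → MKer (d + 1) (Fib d) :=
    fun j κ u => c' • SLam Lc (lamCoeffK (KStepUnit (d := d) Lc (j + 1)) (mmRead Lc (KStepUnit (d := d) Lc j)) Lc) H κ u with hLt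
  set Linf : Fin (d + 1) → (Fin (d + 1) → ℤ) → MKer (d + 1) (Fib d) :=
    fun κ u => c' • SLam Lc (lamCoeffK K₁ (mmRead Lc K₁) Lc) H κ u with hLinf
  set θ' : ℝ := max (max θ θS) (1 / 2) with hθ'
  -- constants and their signs
  have hC : 0 ≤ C := (hK 0).nonneg (Sum.inl 0)
  have hcK : 0 ≤ cK := by have h := (hKrate 0).nonneg (Sum.inl 0); simpa using h
  have hCH : 0 ≤ CH := (hH 0 0).nonneg (Sum.inl 0)
  have hCV : 0 ≤ CV := (hV 0 0).nonneg (Sum.inl 0)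
  have hCs0 : 0 ≤ Cs0 := (hS0 0 0 0).nonneg (Sum.inl 0)
  have hcS : 0 ≤ cS := by have h := (hSall0 0 0 0 0).nonneg (Sum.inl 0); simpa using h
  have hZ2 : 0 ≤ Zl (d + 1) (δ - δ / 2) := Zl_nonneg (by linarith)
  have hZ4 : 0 ≤ Zl (d + 1) (δ / 2 / 2) := Zl_nonneg (by positivity)
  have hθθ' : θ ≤ θ' := (le_max_left _ _).trans (le_max_left _ _)
  have hθSθ' : θS ≤ θ' := (le_max_right _ _).trans (le_max_left _ _)
  have hhalf : 1 / 2 ≤ θ' := le_max_right _ _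
  have hθ'0 : 0 ≤ θ' := hθ0.trans hθθ'
  set CU : ℝ := (d + 1 : ℕ) * (((Fintype.card (Fib d) : ℝ) * (C * C) * Zl (d + 1) (δ - δ / 2)) * CH * Zl (d + 1) (δ / 2 / 2)) with hCU
  set CD : ℝ := (d + 1 : ℕ) * ((2 * ((Fintype.card (Fib d) : ℝ) * (C * cK) * Zl (d + 1) (δ - δ / 2))) * CH * Zl (d + 1) (δ / 2 / 2)) with hCD
  have hCU0 : 0 ≤ CU := by positivity
  have hCD0 : 0 ≤ CD := by positivity
  -- the S-rows at the target rate; the limit and the rate to it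
  have hS0' : ∀ j, LocStencil (St j) Cs0 m := fun j => locStencil_mono (hS0 j) hCs0 hmS
  have hSinf : LocStencil (limStOf St) Cs0 m := locStencil_mono (locStencil_limStOf (S := St) hS0 hSall0 hθS1) hCs0 hmS
  have hSrate : ∀ k, LocStencil (St k - limStOf St) (cS * θS ^ k) m := fun k =>
    locStencil_mono (locStencil_sub_limStOf (S := St) hSall0 hθS1 k) (mul_nonneg hcS (pow_nonneg hθS0 k)) hmS
  -- the Λ-stencils at the target rate
  have hLtloc : ∀ j, LocStencil (Lt j) (|c'| * CU) m := fun j =>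
    locStencil_smul c' (locStencil_mono (locStencil_SLam_KStepUnit hLc hK hδ hH j) hCU0 hmδ)
  have hLinfloc : LocStencil Linf (|c'| * CU) m := locStencil_smul c' (locStencil_mono (locStencil_SLam_lim hLc hKinf hδ hH) hCU0 hmδ)
  have hLrate : ∀ j, LocStencil (Lt j - Linf) (|c'| * (CD * θ ^ j)) m := fun j => by
    have hdiff := locStencil_mono (locStencil_SLam_KStepUnit_sub_lim hLc hK hKinf hKrate hδ hθ0 hθ1.le hH j)
      (by positivity) hmδ
    intro κ u x z a b
    have hb := hdiff κ u x z a b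
    simp only [Pi.sub_apply] at hb
    simp only [hLt, hLinf, Pi.sub_apply, Pi.smul_apply, smul_eq_mul]
    rw [← mul_sub, abs_mul, mul_assoc]
    refine (mul_le_mul_of_nonneg_left hb (abs_nonneg _)).trans (le_of_eq ?_)
    rw [hCD]; ring
  -- member 0 and members j+1 of the pure family, in units
  have hP0 : unitS (sfStep Lc 0) (smStep d Lc 0) (SpureRecOf d Lc V H G cE cVH cΛ 0) = fun κ u => cE • wilsonA d κ u + cVH • V κ u :=
    unitS_SpureRecOf_zero V H G cE cVH cΛ
  have hPs : ∀ j, unitS (sfStep Lc (j + 1)) (smStep d Lc (j + 1)) (SpureRecOf d Lc V H G cE cVH cΛ (j + 1)) = St (j + 1) - Lt j := fun j =>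
    unitS_SpureRecOf_succ V H G cE cVH cΛ hHfm hHm j
  have hW : LocStencil (wilsonA d) (wBound d * Real.exp (4 * m)) m := locStencil_wilsonA hm.le
  have hP0loc : LocStencil (unitS (sfStep Lc 0) (smStep d Lc 0) (SpureRecOf d Lc V H G cE cVH cΛ 0))
      (|cE| * (wBound d * Real.exp (4 * m)) + |cVH| * CV) m := by
    rw [hP0]; exact locStencil_add (locStencil_smul cE hW) (locStencil_smul cVH hV)
  have hPsloc : ∀ j, LocStencil (unitS (sfStep Lc (j + 1)) (smStep d Lc (j + 1)) (SpureRecOf d Lc V H G cE cVH cΛ (j + 1)))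
      (Cs0 + |c'| * CU) m := fun j => by
    rw [hPs j]; exact locStencil_sub (hS0' (j + 1)) (hLtloc j)
  have hPinf : LocStencil (limStOf St - Linf) (Cs0 + |c'| * CU) m := locStencil_sub hSinf hLinfloc
  -- uniform constant
  set Cs : ℝ := (|cE| * (wBound d * Real.exp (4 * m)) + |cVH| * CV) + (Cs0 + |c'| * CU) with hCs
  have hA0 : 0 ≤ |cE| * (wBound d * Real.exp (4 * m)) + |cVH| * CV :=
    add_nonneg (mul_nonneg (abs_nonneg _) (mul_nonneg (wBound_nonneg d) (Real.exp_pos _).le)) (mul_nonneg (abs_nonneg _) hCV)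
  have hB0 : 0 ≤ Cs0 + |c'| * CU := add_nonneg hCs0 (mul_nonneg (abs_nonneg _) hCU0)
  have hunif : ∀ j, LocStencil (unitS (sfStep Lc j) (smStep d Lc j) (SpureRecOf d Lc V H G cE cVH cΛ j)) Cs m := by
    intro j
    cases j with
    | zero => exact locStencil_mono' hP0loc (le_add_of_nonneg_right hB0) le_rfl
    | succ j => exact locStencil_mono' (hPsloc j) (le_add_of_nonneg_left hA0) le_rfl
  -- rate constant
  set cS' : ℝ := (cS + 2 * (|c'| * CD)) + (Cs + (Cs0 + |c'| * CU)) with hcS'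
  have hcS'0 : 0 ≤ cS + 2 * (|c'| * CD) := add_nonneg hcS (mul_nonneg (by norm_num) (mul_nonneg (abs_nonneg _) hCD0))
  have hrate : ∀ j, LocStencil (unitS (sfStep Lc j) (smStep d Lc j) (SpureRecOf d Lc V H G cE cVH cΛ j) - (limStOf St - Linf)) (cS' * θ' ^ j) m := by
    intro j
    cases j with
    | zero =>
      have h := locStencil_sub (hunif 0) hPinf
      refine locStencil_mono' h ?_ le_rfl
      rw [pow_zero, mul_one, hcS']
      exact le_add_of_nonneg_left hcS'0
    | succ j =>
      rw [hPs j, sub_sub_sub_comm]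
      have h := locStencil_sub (hSrate (j + 1)) (hLrate j)
      refine locStencil_mono' h ?_ le_rfl
      have h1 : cS * θS ^ (j + 1) ≤ cS * θ' ^ (j + 1) := mul_le_mul_of_nonneg_left (pow_le_pow_left₀ hθS0 hθSθ' (j + 1)) hcS
      have h2 : |c'| * (CD * θ ^ j) ≤ (2 * (|c'| * CD)) * θ' ^ (j + 1) := by
        have hp := pow_le_two_mul_pow_succ hθ0 hθθ' hhalf j
        have h0 : 0 ≤ |c'| * CD := mul_nonneg (abs_nonneg _) hCD0
        nlinarith
      have h3 : 0 ≤ (Cs + (Cs0 + |c'| * CU)) * θ' ^ (j + 1) := mul_nonneg (add_nonneg (add_nonneg hA0 hB0) hB0) (pow_nonneg hθ'0 _)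
      calc cS * θS ^ (j + 1) + |c'| * (CD * θ ^ j) ≤ cS * θ' ^ (j + 1) + (2 * (|c'| * CD)) * θ' ^ (j + 1) := add_le_add h1 h2
        _ ≤ cS * θ' ^ (j + 1) + (2 * (|c'| * CD)) * θ' ^ (j + 1) + (Cs + (Cs0 + |c'| * CU)) * θ' ^ (j + 1) := le_add_of_nonneg_right h3
        _ = cS' * θ' ^ (j + 1) := by rw [hcS']; ring
  exact ⟨Cs, cS', hunif, locStencil_mono' hPinf (le_add_of_nonneg_left hA0) le_rfl, hrate⟩

end Rows

end Summit.QuantumFields.BalabanUV.Beta.FP.PureStencilRows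

end
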